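import Mathlib
import HarnessLib

/-!
# Banach limits

A **Banach limit** (Banach 1932; Conway [cite: Conway1985, §III.7, Thm 7.1]; Rudin
[cite: Rudin1991, Ch. 3, Exercise 4]) is a linear functional
on bounded real sequences which is positive, normalised, invariant under the shift
`(a n)ₙ ↦ (a (n+1))ₙ`, and hence squeezed between `liminf` and `limsup`; in particular it extends
the ordinary limit.  Mathlib has no Banach limit; the tree has an ultrafilter limit without shift
invariance (Summits, Crystallization `stub_banachLimit`).

We give the classical explicit construction: the limit of the **Cesàro means**
`cesaro a n = (a 0 + ⋯ + a n) / (n + 1)` along the free ultrafilter `Filter.hyperfilter ℕ`.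
Shift invariance comes from `cesaro (shift a) n - cesaro a n = (a (n+1) - a 0) / (n+1) → 0`.

* `banachLimit a` — the functional (meaningful for bounded `a`; every statement below carries the
  boundedness hypothesis `∀ n, |a n| ≤ M` where needed);
* `banachLimit_add`, `banachLimit_smul`, `banachLimit_const`, `banachLimit_nonneg`,
  `abs_banachLimit_le` — linear, normalised, positive, of norm `≤ 1`;
* `banachLimit_shift`, `banachLimit_shift_add` — **shift invariance**;
* `banachLimit_le_of_eventually_le`, `le_banachLimit_of_eventually_le` — the `liminf/limsup`
  sandwich in junk-free eventual form; `banachLimit_eq_of_tendsto` — it extends the limit;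
  `banachLimit_eq_zero_of_eventually_zero`;
* `exists_banachLimit` — **existence of Banach limits** packaged as a linear functional on all real
  sequences (linear extension from the bounded ones, `LinearMap.exists_extend`) agreeing with
  `banachLimit` on bounded sequences.
-/

open Filter Topology Finset

noncomputable section

namespace Literature.Analysis.FunctionSpaces.BanachLimit

/-! ### Cesàro means -/

/-- The Cesàro mean `(a 0 + ⋯ + a n) / (n + 1)`. [folklore] -/
def cesaro (a : ℕ → ℝ) (n : ℕ) : ℝ := (∑ j ∈ range (n + 1), a j) / (n + 1)

/-- [folklore] -/
private theorem cesaro_add (a b : ℕ → ℝ) (n : ℕ) : cesaro (a + b) n = cesaro a n + cesaro b n := by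
  simp [cesaro, sum_add_distrib, add_div]

/-- [folklore] -/
private theorem cesaro_smul (t : ℝ) (a : ℕ → ℝ) (n : ℕ) : cesaro (t • a) n = t * cesaro a n := by
  simp [cesaro, ← mul_sum, mul_div_assoc]

/-- [folklore] -/
private theorem cesaro_const (c : ℝ) (n : ℕ) : cesaro (fun _ => c) n = c := by
  simp only [cesaro, sum_const, card_range, nsmul_eq_mul]
  have : (n : ℝ) + 1 ≠ 0 := by positivity
  field_simp
  push_cast
  ring

/-- Cesàro means of a sequence with terms `≤ t` are `≤ t`. [folklore] -/
private theorem cesaro_le_of_le {a : ℕ → ℝ} {t : ℝ} (h : ∀ n, a n ≤ t) (n : ℕ) : cesaro a n ≤ t := by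
  unfold cesaro
  rw [div_le_iff₀ (by positivity)]
  calc ∑ j ∈ range (n + 1), a j ≤ ∑ _j ∈ range (n + 1), t := sum_le_sum fun j _ => h j
    _ = t * (n + 1) := by simp [mul_comm]

/-- Cesàro means of a sequence with terms `≥ t` are `≥ t`. [folklore] -/
private theorem le_cesaro_of_le {a : ℕ → ℝ} {t : ℝ} (h : ∀ n, t ≤ a n) (n : ℕ) : t ≤ cesaro a n := by
  unfold cesaro
  rw [le_div_iff₀ (by positivity)]
  calc t * (n + 1) = ∑ _j ∈ range (n + 1), t := by simp [mul_comm]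
    _ ≤ ∑ j ∈ range (n + 1), a j := sum_le_sum fun j _ => h j

/-- `|cesaro a n| ≤ M` if `|a n| ≤ M` for all `n`. [folklore] -/
private theorem abs_cesaro_le {a : ℕ → ℝ} {M : ℝ} (hM : ∀ n, |a n| ≤ M) (n : ℕ) : |cesaro a n| ≤ M :=
  abs_le.mpr ⟨by simpa using le_cesaro_of_le (fun n => (abs_le.mp (hM n)).1) n,
    cesaro_le_of_le (fun n => (abs_le.mp (hM n)).2) n⟩

/-- The Cesàro means of the shifted sequence differ from those of the sequence by
`(a (n+1) - a 0) / (n+1)`. [folklore] -/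
private theorem cesaro_shift_sub (a : ℕ → ℝ) (n : ℕ) :
    cesaro (fun k => a (k + 1)) n - cesaro a n = (a (n + 1) - a 0) / (n + 1) := by
  unfold cesaro
  rw [← sub_div]
  congr 1
  have h := sum_range_succ' a (n + 1)
  rw [sum_range_succ] at h
  linarith

/-- For a bounded sequence this difference tends to `0`. [folklore] -/
private theorem tendsto_cesaro_shift_sub {a : ℕ → ℝ} {M : ℝ} (hM : ∀ n, |a n| ≤ M) :
    Tendsto (fun n => cesaro (fun k => a (k + 1)) n - cesaro a n) atTop (𝓝 0) := by
  simp_rw [cesaro_shift_sub]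
  have hM0 : 0 ≤ M := (abs_nonneg _).trans (hM 0)
  have h2 : Tendsto (fun n : ℕ => 2 * M * (1 / ((n : ℝ) + 1))) atTop (𝓝 0) := by
    simpa using tendsto_one_div_add_atTop_nhds_zero_nat.const_mul (2 * M)
  refine squeeze_zero_norm (fun n => ?_) h2
  rw [Real.norm_eq_abs, abs_div, abs_of_pos (by positivity : (0 : ℝ) < n + 1), div_eq_mul_one_div]
  gcongr
  calc |a (n + 1) - a 0| ≤ |a (n + 1)| + |a 0| := abs_sub _ _
    _ ≤ M + M := add_le_add (hM _) (hM _)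
    _ = 2 * M := by ring

/-! ### The free ultrafilter and the functional -/

/-- The hyperfilter refines `atTop` on `ℕ`. [folklore] -/
private theorem hyperfilter_le_atTop : (↑(hyperfilter ℕ) : Filter ℕ) ≤ atTop :=
  hyperfilter_le_cofinite.trans_eq Nat.cofinite_eq_atTop

/-- A bounded real sequence converges along the hyperfilter. [folklore] -/
private theorem exists_tendsto_hyperfilter {u : ℕ → ℝ} {M : ℝ} (hM : ∀ n, |u n| ≤ M) :
    ∃ l : ℝ, Tendsto u (↑(hyperfilter ℕ) : Filter ℕ) (𝓝 l) := by
  have hmem : Set.Icc (-M) M ∈ Ultrafilter.map u (hyperfilter ℕ) :=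
    Ultrafilter.mem_map.2 (univ_mem' fun n => Set.mem_preimage.2 (Set.mem_Icc.2 (abs_le.1 (hM n))))
  obtain ⟨l, -, hl⟩ := isCompact_Icc.ultrafilter_le_nhds' _ hmem
  refine ⟨l, ?_⟩
  rw [Ultrafilter.coe_map] at hl
  exact hl

/-- **The Banach limit**: the limit of the Cesàro means along the free ultrafilter
`hyperfilter ℕ` (an arbitrary value for unbounded sequences). [cite: Conway1985, §III.7, Thm 7.1] -/
def banachLimit (a : ℕ → ℝ) : ℝ := limUnder (↑(hyperfilter ℕ) : Filter ℕ) (cesaro a)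

/-- For a bounded sequence the Cesàro means converge to `banachLimit a` along the hyperfilter.
[cite: Conway1985, §III.7, Thm 7.1 (existence of a Banach limit; realised here by Cesàro means along
`hyperfilter ℕ` instead of Hahn–Banach)] -/
theorem tendsto_banachLimit {a : ℕ → ℝ} {M : ℝ} (hM : ∀ n, |a n| ≤ M) :
    Tendsto (cesaro a) (↑(hyperfilter ℕ) : Filter ℕ) (𝓝 (banachLimit a)) :=
  tendsto_nhds_limUnder (exists_tendsto_hyperfilter (abs_cesaro_le hM))

/-! ### Linearity, positivity, normalisation -/

/-- [cite: Conway1985, §III.7, Thm 7.1 (L is linear)] -/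
theorem banachLimit_add {a b : ℕ → ℝ} {Ma Mb : ℝ} (ha : ∀ n, |a n| ≤ Ma) (hb : ∀ n, |b n| ≤ Mb) :
    banachLimit (a + b) = banachLimit a + banachLimit b := by
  have hab : ∀ n, |(a + b) n| ≤ Ma + Mb := fun n => (abs_add_le _ _).trans (add_le_add (ha n) (hb n))
  refine tendsto_nhds_unique (tendsto_banachLimit hab) ?_
  have h := (tendsto_banachLimit ha).add (tendsto_banachLimit hb)
  exact h.congr fun n => (cesaro_add a b n).symm

/-- [cite: Conway1985, §III.7, Thm 7.1 (L is linear)] -/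
theorem banachLimit_smul {a : ℕ → ℝ} {M : ℝ} (ha : ∀ n, |a n| ≤ M) (t : ℝ) :
    banachLimit (t • a) = t * banachLimit a := by
  have hta : ∀ n, |(t • a) n| ≤ |t| * M := fun n => by
    rw [Pi.smul_apply, smul_eq_mul, abs_mul]; exact mul_le_mul_of_nonneg_left (ha n) (abs_nonneg t)
  refine tendsto_nhds_unique (tendsto_banachLimit hta) ?_
  exact ((tendsto_banachLimit ha).const_mul t).congr fun n => (cesaro_smul t a n).symm

/-- [cite: Conway1985, §III.7, Thm 7.1 (L is linear)] -/
theorem banachLimit_neg {a : ℕ → ℝ} {M : ℝ} (ha : ∀ n, |a n| ≤ M) :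
    banachLimit (-a) = -banachLimit a := by
  have h := banachLimit_smul ha (-1)
  simp only [neg_smul, one_smul, neg_mul, one_mul] at h
  exact h

/-- The Banach limit of a constant sequence. [cite: Conway1985, §III.7, Thm 7.1 (L(1) = 1, linearity)] -/
theorem banachLimit_const (c : ℝ) : banachLimit (fun _ => c) = c := by
  have hc : ∀ n : ℕ, |(fun _ : ℕ => c) n| ≤ |c| := fun _ => le_rfl
  refine tendsto_nhds_unique (tendsto_banachLimit hc) ?_
  exact tendsto_const_nhds.congr fun n => (cesaro_const c n).symm

/-- Normalisation: `banachLimit 1 = 1`. [cite: Conway1985, §III.7, Thm 7.1] -/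
theorem banachLimit_one : banachLimit (fun _ => (1 : ℝ)) = 1 := banachLimit_const 1

/-- Upper bound by a uniform bound of the terms. [cite: Conway1985, §III.7, Thm 7.1 (c) (positivity ⇒
monotone bound)] -/
theorem banachLimit_le_of_le {a : ℕ → ℝ} {M t : ℝ} (ha : ∀ n, |a n| ≤ M) (h : ∀ n, a n ≤ t) :
    banachLimit a ≤ t :=
  le_of_tendsto' (tendsto_banachLimit ha) fun n => cesaro_le_of_le h n

/-- Lower bound by a uniform bound of the terms. [cite: Conway1985, §III.7, Thm 7.1 (c) (positivity ⇒
monotone bound)] -/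
theorem le_banachLimit_of_le {a : ℕ → ℝ} {M t : ℝ} (ha : ∀ n, |a n| ≤ M) (h : ∀ n, t ≤ a n) :
    t ≤ banachLimit a :=
  ge_of_tendsto' (tendsto_banachLimit ha) fun n => le_cesaro_of_le h n

/-- Positivity. [cite: Conway1985, §III.7, Thm 7.1] -/
theorem banachLimit_nonneg {a : ℕ → ℝ} {M : ℝ} (ha : ∀ n, |a n| ≤ M) (h : ∀ n, 0 ≤ a n) :
    0 ≤ banachLimit a :=
  le_banachLimit_of_le ha h

/-- `|banachLimit a| ≤ M` whenever `|a n| ≤ M` for all `n` (norm at most one).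
[cite: Conway1985, §III.7, Thm 7.1] -/
theorem abs_banachLimit_le {a : ℕ → ℝ} {M : ℝ} (ha : ∀ n, |a n| ≤ M) : |banachLimit a| ≤ M :=
  abs_le.mpr ⟨le_banachLimit_of_le ha fun n => (abs_le.mp (ha n)).1,
    banachLimit_le_of_le ha fun n => (abs_le.mp (ha n)).2⟩

/-! ### Shift invariance and the `liminf / limsup` sandwich -/

/-- **Shift invariance.** [cite: Conway1985, §III.7, Thm 7.1] [cite: Rudin1991, Ch. 3, Exercise 4] -/
theorem banachLimit_shift {a : ℕ → ℝ} {M : ℝ} (ha : ∀ n, |a n| ≤ M) :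
    banachLimit (fun n => a (n + 1)) = banachLimit a := by
  have ha' : ∀ n, |a (n + 1)| ≤ M := fun n => ha (n + 1)
  refine tendsto_nhds_unique (tendsto_banachLimit ha') ?_
  have h0 : Tendsto (fun n => cesaro (fun k => a (k + 1)) n - cesaro a n) (↑(hyperfilter ℕ) : Filter ℕ)
      (𝓝 0) := (tendsto_cesaro_shift_sub ha).mono_left hyperfilter_le_atTop
  have h := h0.add (tendsto_banachLimit ha)
  simp only [zero_add, sub_add_cancel] at h
  exact h

/-- Invariance under the `N`-fold shift. [cite: Conway1985, §III.7, Thm 7.1 (d), iterated as in Claim 7.3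
(L(x) = L(x⁽ⁿ⁾))] -/
theorem banachLimit_shift_add {a : ℕ → ℝ} {M : ℝ} (ha : ∀ n, |a n| ≤ M) (N : ℕ) :
    banachLimit (fun n => a (n + N)) = banachLimit a := by
  induction N with
  | zero => rfl
  | succ N ih =>
    have haN : ∀ n, |a (n + N)| ≤ M := fun n => ha (n + N)
    have h := banachLimit_shift haN
    simp only [add_assoc, add_comm 1 N] at h
    rw [← ih, ← h]

/-- `banachLimit a ≤ limsup a`, in eventual form. [cite: Conway1985, §III.7, Thm 7.1] -/
theorem banachLimit_le_of_eventually_le {a : ℕ → ℝ} {M t : ℝ} (ha : ∀ n, |a n| ≤ M)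
    (h : ∀ᶠ n in atTop, a n ≤ t) : banachLimit a ≤ t := by
  obtain ⟨N, hN⟩ := eventually_atTop.mp h
  rw [← banachLimit_shift_add ha N]
  exact banachLimit_le_of_le (M := M) (fun n => ha (n + N)) fun n => hN (n + N) (Nat.le_add_left N n)

/-- `liminf a ≤ banachLimit a`, in eventual form. [cite: Conway1985, §III.7, Thm 7.1] -/
theorem le_banachLimit_of_eventually_le {a : ℕ → ℝ} {M t : ℝ} (ha : ∀ n, |a n| ≤ M)
    (h : ∀ᶠ n in atTop, t ≤ a n) : t ≤ banachLimit a := by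
  obtain ⟨N, hN⟩ := eventually_atTop.mp h
  rw [← banachLimit_shift_add ha N]
  exact le_banachLimit_of_le (M := M) (fun n => ha (n + N)) fun n => hN (n + N) (Nat.le_add_left N n)

/-- **A Banach limit extends the limit.** [cite: Conway1985, §III.7, Thm 7.1] -/
theorem banachLimit_eq_of_tendsto {a : ℕ → ℝ} {l : ℝ} (h : Tendsto a atTop (𝓝 l)) :
    banachLimit a = l := by
  -- a convergent sequence is bounded
  obtain ⟨C, hC⟩ := isBounded_iff_forall_norm_le.mp (Metric.isBounded_range_of_tendsto a h)
  have ha : ∀ n, |a n| ≤ C := fun n => by simpa using hC (a n) (Set.mem_range_self n)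
  refine le_antisymm ?_ ?_
  · refine le_of_forall_pos_le_add fun ε hε => ?_
    exact banachLimit_le_of_eventually_le ha
      ((h.eventually (eventually_le_nhds (lt_add_of_pos_right l hε))).mono fun n hn => hn)
  · refine le_of_forall_pos_le_add fun ε hε => ?_
    have hev : ∀ᶠ n in atTop, l - ε ≤ a n :=
      (h.eventually (eventually_ge_nhds (sub_lt_self l hε))).mono fun n hn => hn
    linarith [le_banachLimit_of_eventually_le ha hev]

/-- A Banach limit vanishes on eventually-zero sequences. [cite: Conway1985, §III.7, Thm 7.1 (b) / Claim 7.3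
(c₀ ⊆ ker L)] -/
theorem banachLimit_eq_zero_of_eventually_zero {a : ℕ → ℝ} {N : ℕ} (h : ∀ n, N ≤ n → a n = 0) :
    banachLimit a = 0 :=
  banachLimit_eq_of_tendsto
    (tendsto_const_nhds.congr' ((eventually_ge_atTop N).mono fun n hn => (h n hn).symm))

/-! ### Packaged existence theorem -/

/-- The bounded real sequences as a submodule of `ℕ → ℝ`. [folklore] -/
def boundedSeq : Submodule ℝ (ℕ → ℝ) where
  carrier := {a | ∃ M : ℝ, ∀ n, |a n| ≤ M}
  zero_mem' := ⟨0, fun n => by simp⟩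
  add_mem' := by
    rintro a b ⟨Ma, ha⟩ ⟨Mb, hb⟩
    exact ⟨Ma + Mb, fun n => (abs_add_le _ _).trans (add_le_add (ha n) (hb n))⟩
  smul_mem' := by
    rintro t a ⟨M, ha⟩
    refine ⟨|t| * M, fun n => ?_⟩
    rw [Pi.smul_apply, smul_eq_mul, abs_mul]
    exact mul_le_mul_of_nonneg_left (ha n) (abs_nonneg t)

/-- `banachLimit` as a linear map on the bounded sequences. [folklore] -/
def banachLimitLinear : boundedSeq →ₗ[ℝ] ℝ where
  toFun a := banachLimit (a : ℕ → ℝ)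
  map_add' a b := by
    obtain ⟨Ma, ha⟩ := a.2
    obtain ⟨Mb, hb⟩ := b.2
    exact banachLimit_add ha hb
  map_smul' t a := by
    obtain ⟨M, ha⟩ := a.2
    exact banachLimit_smul ha t

/-- **Existence of Banach limits** (Banach 1932; Conway, Thm III.7.1): there is a linear
functional `Λ` on all real sequences which on bounded sequences is the Banach limit — hence is
positive, normalised (`Λ 1 = 1`), shift invariant, squeezed between `liminf` and `limsup`, and
equal to the limit on convergent sequences (use the `banachLimit_*` lemmas through the agreement).
[cite: Conway1985, §III.7, Thm 7.1] -/
theorem exists_banachLimit :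
    ∃ Λ : (ℕ → ℝ) →ₗ[ℝ] ℝ, ∀ a : ℕ → ℝ, (∃ M : ℝ, ∀ n, |a n| ≤ M) → Λ a = banachLimit a := by
  obtain ⟨g, hg⟩ := LinearMap.exists_extend banachLimitLinear
  refine ⟨g, fun a ha => ?_⟩
  have h := LinearMap.congr_fun hg ⟨a, ha⟩
  simpa [banachLimitLinear] using h

/-- The packaged classical statement: a linear functional on all real sequences which, on bounded
sequences, is shift invariant, lies between the eventual lower and upper bounds (so between
`liminf` and `limsup`), and extends the limit — Rudin's Exercise 3.4 (a), (b).
[cite: Conway1985, §III.7, Thm 7.1] [cite: Rudin1991, Ch. 3, Exercise 4] -/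
theorem exists_banachLimit' :
    ∃ Λ : (ℕ → ℝ) →ₗ[ℝ] ℝ,
      (∀ a : ℕ → ℝ, ∀ M : ℝ, (∀ n, |a n| ≤ M) → Λ (fun n => a (n + 1)) = Λ a) ∧
      (∀ a : ℕ → ℝ, ∀ M t : ℝ, (∀ n, |a n| ≤ M) → (∀ᶠ n in atTop, a n ≤ t) → Λ a ≤ t) ∧
      (∀ a : ℕ → ℝ, ∀ M t : ℝ, (∀ n, |a n| ≤ M) → (∀ᶠ n in atTop, t ≤ a n) → t ≤ Λ a) ∧
      (∀ a : ℕ → ℝ, ∀ l : ℝ, Tendsto a atTop (𝓝 l) → Λ a = l) := by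
  obtain ⟨Λ, hΛ⟩ := exists_banachLimit
  refine ⟨Λ, fun a M ha => ?_, fun a M t ha h => ?_, fun a M t ha h => ?_, fun a l h => ?_⟩
  · rw [hΛ a ⟨M, ha⟩, hΛ _ ⟨M, fun n => ha (n + 1)⟩, banachLimit_shift ha]
  · rw [hΛ a ⟨M, ha⟩]; exact banachLimit_le_of_eventually_le ha h
  · rw [hΛ a ⟨M, ha⟩]; exact le_banachLimit_of_eventually_le ha h
  · obtain ⟨C, hC⟩ := isBounded_iff_forall_norm_le.mp (Metric.isBounded_range_of_tendsto a h)
    have ha : ∀ n, |a n| ≤ C := fun n => by simpa using hC (a n) (Set.mem_range_self n)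
    rw [hΛ a ⟨C, ha⟩]; exact banachLimit_eq_of_tendsto h

#harness_tags banachLimit_shift
#harness_tags exists_banachLimit'

end Literature.Analysis.FunctionSpaces.BanachLimit
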